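import Mathlib
import Literature.MathematicalPhysics.MHD.ShafranovShift
import Literature.MathematicalPhysics.MHD.RFPModelEquilibrium
import HarnessLib

/-!
# F2 row «F2.SHAFRANOV-SHIFT-RFP-FIG66»: the toroidal correction of FREIDBERG'S MODEL RFP EQUILIBRIUM (5.42)/(5.44)/(5.47) at the printed Fig. 6.6 parameters `α_z = 1.1`, `a/R₀ = 1/5` — `l_i(α_p)` in closed form (`l_i(0) = 22451/15180`), `β_p = 15α_p/(15α_p + 2.53)`, OUTWARD shift of every interior surface, the left edge slope `Δ′(a⁻) = −(1/5)(β_p + l_i/2)` (`= −22451/151800` at `β_p = 0`), and the axis shift as Freidberg's quadrature (6.75) (lit-4's `ShafranovShift` v5 + `RFPModelEquilibrium`)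

LADDER-GRIDFUSION rung F2 (cell `gridfusion`; lead g12 RULING 9ev (2) «#195 (template #5, OFFER F) after #192's OT is filed»):
statements + proofs by gridfusion-lit-4 g11 (TEMPLATE #5 `HOME/lean/lit-4/templates/ShafranovShiftRFP11.lean` 5c7279f811f408c2, OFFER F,
INBOX 2026-08-28T02:55:25Z) over its kernel files `Literature/MathematicalPhysics/MHD/ShafranovShift.lean` (≥ v5, p599290; Freidberg §6.4.2–6.4.6
read on the page) and `RFPModelEquilibrium.lean` (Freidberg §5.4.6 (5.42)/(5.44)/(5.47), (5.52)); FILED UNCHANGED but for hygiene (imports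
`Mathlib`/`HarnessLib`, this module docstring, one-line docstrings / `[instance data]` tags on the two declarations that had none) by
gridfusion-model-7 g8, 2026-08-28.  Every other declaration, statement and proof below is lit-4's, byte-identical.  0 kit, 0 named facts,
no `native_decide`.  The optional kit object of the offer — a certified ENCLOSURE of the axis-shift quadrature `Δ₀/a = (1/5)∫₀¹ x·g/bθSlopeSq`
— is the certnum cell's RQ-021 (lead 9et (5) / 9eu (4)), an ∘ENCLOSURE companion, never part of this file's CERTIFIED column.

THREE COLUMNS (lit-4's OFFER F verbatim).  CERTIFIED: for FREIDBERG'S MODEL RFP EQUILIBRIUM (5.42)/(5.44)/(5.47) at the printed Fig. 6.6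
parameters `α_z = 1.1`, `a/R₀ = 1/5` (`μ₀ = B_z0 = a = 1`, `R₀ = 5`), in the first-order `ε`-expansion (6.58)/(6.65)–(6.67)/(6.72)/(6.77):
`l_i(α_p) = 2(69α_p/280 + 22451/180000)/(α_p + 253/1500)` (6.86), `l_i(0) = 22451/15180 ∈ (1.4789, 1.4790)`; `β_p = 15α_p/(15α_p + 2.53)`
(5.52); every interior flux surface shifted OUTWARD (`Δ(r) > 0`, `0 < r < a`); the edge slope as a LEFT derivative `Δ′(a⁻) = −(a/R₀)(β_p + l_i/2)`,
`= −22451/151800 ∈ (−0.1480, −0.1478)` at `β_p = 0`; the axis shift `Δ₀/a = (a/R₀)∫₀¹ x·g/(B_θ′-slope²) dx` (6.75) with `g` DERIVED in the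
kernel from (6.73)–(6.74) (`Profile.rfpAxisShiftG`, see its TRANSCRIPTION NOTE).  VALIDATED: Freidberg Fig. 6.6 (`Δ₀/a` vs `β_p` at `α_z = 1.1`,
`R₀/a = 5`; image not machine-read): float shadows `0.04423` at `β_p = 0`, `0.04644` at `β_p = 0.1` (certnum RQ-021 encloses them; ∘ column);
agreement expected at `β_p = 0`, disagreement growing with `β_p` EXPECTED if the figure used the printed `α_p`-polynomial (OCR
«(α_p/3)(109x⁴ − 200x¹⁰ + 98x¹⁶)», inconsistent with the book's own (6.87)) — lit-4 STATUS 02:47Z; no Grad–Shafranov code in the cell.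
MODELLED: first-order large-aspect-ratio expansion, circular boundary `r₂ = a`, ideal MHD, the model profiles «a simple choice» (Freidberg),
no device.  Citations: Freidberg 2014 §5.4.6, §6.4 [Freidberg2014].  Everything below is [instance data].

lit-4's template header, verbatim:

> TEMPLATE #5 (gridfusion lit-4 g11, 2026-08-28): «F2.SHAFRANOV-SHIFT-RFP-FIG66» — the toroidal correction of
> FREIDBERG'S OWN MODEL RFP EQUILIBRIUM (5.42)/(5.44)/(5.47) at the printed Fig. 6.6 parameters `α_z = 1.1`,
> `a/R₀ = 1/5` (`μ₀ = B_z0 = a = 1`, `R₀ = 5`), pressure parameter `α_p ≥ 0` free (`β_p = 15α_p/(15α_p + 253/100)`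
> by `RFP.rfpBetaP_profile`).  Kernel engine: Literature/MathematicalPhysics/MHD/ShafranovShift.lean ≥ v5 (p599290)
> + RFPModelEquilibrium.lean.  CERTIFIED here (0 kit): operating range, `l_i(α_p)` closed form (`l_i(0) = 22451/15180
> ∈ (1.4789, 1.4790)`), the LEFT edge slope `Δ′(a⁻) = −(1/5)(β_p + l_i/2)` (`= −22451/151800 ∈ (−0.1480, −0.1478)` at
> `α_p = 0`), outward shift of every interior surface, and the axis shift as Freidberg's quadrature (6.75)
> `Δ₀ = (1/5)∫₀¹ x·g(x)/bθSlopeSq(x) dx` (DERIVED `g`, see the TRANSCRIPTION NOTE on `rfpAxisShiftG`; a certified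
> enclosure of this integral is the producer's kit object — float shadow 0.04423 at α_p = 0, 0.04644 at β_p = 0.1).
> VALIDATED: Fig. 6.6 (image, not machine-read; expect disagreement growing with β_p if the figure used the printed
> α_p-polynomial — lit-4 STATUS 02:47Z).  MODELLED: first-order ε-expansion, circular boundary, ideal MHD, no device.
> Model seats: move into your namespace / file name; nothing here is booked or filed by lit-4.
-/

noncomputable section

open Set Real MeasureTheory intervalIntegral Filter Topology Literature.MathematicalPhysics.MHD
  Literature.MathematicalPhysics.MHD.ScrewPinch

namespace Summit.Ventures.FusionMHD.Models

namespace RFPTorus11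

/-- Freidberg's model RFP equilibrium at `α_z = 11/10` with `μ₀ = B_z0 = a = 1`, pressure parameter `α_p`. [instance data] -/
def Q (αp : ℝ) : ScrewPinch.Profile := RFP.profile 1 1 1 αp (11 / 10)

/-- Unfolding lemma for `Q`. [instance data] -/
theorem Q_def (αp : ℝ) : Q αp = RFP.profile 1 1 1 αp (11 / 10) := rfl

/-- The printed operating range holds: `0 < α_z = 1.1 ≤ 10/7` and `B_θa²/B_z0² = α_p + 253/1500 > 0`. [instance data] -/
theorem range {αp : ℝ} (hαp : 0 ≤ αp) :
    (0:ℝ) < 11 / 10 ∧ (11 / 10 : ℝ) ≤ 10 / 7 ∧ 0 < αp + 11 / 10 * (10 - 7 * (11 / 10)) / 15 := by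
  refine ⟨by norm_num, by norm_num, ?_⟩
  nlinarith

/-- **`l_i(α_p) = 2(69α_p/280 + 22451/180000)/(α_p + 253/1500)`** (Freidberg (6.86) on (5.47)). [instance data] -/
theorem internalInductance_eq {αp : ℝ} (hαp : 0 ≤ αp) :
    (Q αp).internalInductance 1 = 2 * (69 / 280 * αp + 22451 / 180000) / (αp + 253 / 1500) := by
  rw [Q_def, Profile.internalInductance_rfpProfile one_pos one_ne_zero hαp (by norm_num) (by norm_num)]
  norm_num

/-- **At zero pressure: `l_i = 22451/15180 ∈ (1.4789, 1.4790)`.** [instance data] -/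
theorem internalInductance_zero : (Q 0).internalInductance 1 = 22451 / 15180 := by
  rw [internalInductance_eq le_rfl]
  norm_num

/-- **`1.4789 < l_i(0) < 1.4790`.** [instance data] -/
theorem internalInductance_zero_bounds :
    (1.4789 : ℝ) < (Q 0).internalInductance 1 ∧ (Q 0).internalInductance 1 < 1.4790 := by
  rw [internalInductance_zero]
  constructor <;> norm_num

/-- **`β_p = 15α_p/(15α_p + 253/100)`** BY NAME (`RFP.rfpBetaP_profile`, (11.242)/(5.52)). [instance data] -/
theorem rfpBetaP_eq {αp : ℝ} (hαp : 0 ≤ αp) :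
    (Q αp).rfpBetaP 1 = 15 * αp / (15 * αp + 11 / 10 * (10 - 7 * (11 / 10))) := by
  rw [Q_def]
  exact RFP.rfpBetaP_profile one_pos one_ne_zero one_ne_zero (range hαp).2.2.le

/-- **THE LEFT EDGE SLOPE `Δ′(a⁻) = −(1/5)(β_p + l_i/2)`** (model given on `[0, a]`; `R₀ = 5`). [instance data] -/
theorem edgeSlope {αp : ℝ} (hαp : 0 ≤ αp) :
    HasDerivWithinAt (fun s => (Q αp).fluxShift 5 1 s)
      (-(1 / 5 * ((Q αp).rfpBetaP 1 + (Q αp).internalInductance 1 / 2))) (Iic 1) 1 := by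
  rw [Q_def]
  exact Profile.hasDerivWithinAt_fluxShift_edge_rfpProfile (by norm_num) one_ne_zero one_pos hαp (by norm_num)
    (by norm_num) (range hαp).2.2

/-- **At zero pressure: `Δ′(a⁻) = −22451/151800 ∈ (−0.1480, −0.1478)`.** [instance data] -/
theorem edgeSlope_zero :
    HasDerivWithinAt (fun s => (Q 0).fluxShift 5 1 s) (-(22451 / 151800)) (Iic 1) 1 := by
  have h := edgeSlope le_rfl
  rw [rfpBetaP_eq le_rfl, internalInductance_zero] at h
  refine h.congr_deriv ?_
  norm_num

/-- **EVERY INTERIOR SURFACE IS SHIFTED OUTWARD**: `Δ(r) > 0` for `0 < r < 1`. [instance data] -/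
theorem fluxShift_pos {αp r : ℝ} (hαp : 0 ≤ αp) (hr : 0 < r) (hr1 : r < 1) : 0 < (Q αp).fluxShift 5 1 r := by
  rw [Q_def]
  exact Profile.fluxShift_pos_rfpProfile (by norm_num) one_pos one_ne_zero one_pos hαp (by norm_num) (by norm_num)
    (range hαp).2.2 hr hr1

/-- **THE AXIS SHIFT AS FREIDBERG'S QUADRATURE (6.75)**: `Δ(r) → Δ₀ = (1/5)∫₀¹ x·g(x)/bθSlopeSq(x) dx` as `r → 0⁺`
(the producer certifies the enclosure of this integral by kit; float shadow `0.04423` at `α_p = 0`). [instance data] -/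
theorem axisShift {αp : ℝ} (hαp : 0 ≤ αp) :
    Tendsto (fun r => (Q αp).fluxShift 5 1 r) (𝓝[>] 0)
      (𝓝 (1 / 5 * ∫ x in (0:ℝ)..1,
        x * Profile.rfpAxisShiftG αp (11 / 10) x / RFP.bθSlopeSq αp (11 / 10) x)) := by
  have h := Profile.tendsto_fluxShift_rfpProfile_axis (μ₀ := 1) (Bz0 := 1) (a := 1) (αp := αp) (αz := 11 / 10)
    (R₀ := 5) (by norm_num) one_ne_zero one_ne_zero one_pos hαp (by norm_num) (by norm_num) (range hαp).2.2
  rw [Q_def]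
  simp only [div_one] at h
  exact h

end RFPTorus11

end Summit.Ventures.FusionMHD.Models

end
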